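import Mathlib
import Literature.Probability.LatticeModels.ProdBernoulliIndependence
import Literature.Probability.Percolation.LongRangeKernelPercolationProofs
import Literature.Probability.Percolation.PercolationProofs
import HarnessLib

/-!
# Weight continuity: `stub_weightContinuity`

This file proves `stub_weightContinuity`.

On the finite index set `Sym2 (Fin n)` every event `E` of bond configurations is determined by
the (finite) set of all coordinates, so `w ↦ (prodBernoulli w).real E` is a finite sum over the
atoms `ω₀ ∈ E` of the products `∏ₑ (w e if e ∈ ω₀ else 1 - w e)`, hence continuous in the
weights for the product topology on `Sym2 (Fin n) → [0, 1]`.  This is the special case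
`X := Sym2 (Fin n) → [0, 1]`, `p := id`, `F := Finset.univ` of the library lemma
`Literature.Probability.Percolation.continuous_prodBernoulli_real_of_determinedBy`
(Grimmett 1999, §7.3 p. 162: "`P_p(A)` is a finite polynomial … therefore continuous").
-/

namespace Summit.CriticalPhenomena.PercolationContinuityZ3.Theorems

open scoped BigOperators Classical
open MeasureTheory Set
open Literature.Probability.LatticeModels (prodBernoulli)
open Literature.Probability.Percolation (DeterminedBy continuous_prodBernoulli_real_of_determinedBy)

/-- On a finite index type every event of configurations is determined by the full (finite)
coordinate set `Finset.univ`. -/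
theorem determinedBy_coe_univ {ι : Type*} [Fintype ι] (E : Set (Set ι)) :
    DeterminedBy E (↑(Finset.univ : Finset ι) : Set ι) := by
  rw [Finset.coe_univ]
  exact dependsOn_univ _

/-- Each weight coordinate `w ↦ (w e : ℝ)` is continuous on `ι → [0, 1]` (product topology,
`[0, 1]` with the subspace topology of `ℝ`). -/
theorem continuous_coe_weight_apply {ι : Type*} (e : ι) :
    Continuous fun w : ι → unitInterval => (w e : ℝ) :=
  continuous_subtype_val.comp (continuous_apply e)

/-- **Weight continuity**: on the finite index set `Sym2 (Fin n)`, the probability of any event of bond configurations is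
continuous in the weights (product topology on `Sym2 (Fin n) → [0, 1]`); see the module docstring. -/
theorem stub_weightContinuity :
    ∀ (n : ℕ) (E : Set (Literature.Probability.Percolation.BondConfig (Fin n))),
      Continuous fun w : Sym2 (Fin n) → unitInterval =>
        (Literature.Probability.LatticeModels.prodBernoulli w).real E := by
  intro n E
  exact continuous_prodBernoulli_real_of_determinedBy (fun w : Sym2 (Fin n) → unitInterval => w)
    (determinedBy_coe_univ E) fun e _ => continuous_coe_weight_apply e

end Summit.CriticalPhenomena.PercolationContinuityZ3.Theorems
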